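import Summits.CriticalPhenomena.PercolationContinuityZ3.Theorems.PercNearOneGluingNoHeavyLowerTailSahiPair43LinkWalk
import Summits.CriticalPhenomena.PercolationContinuityZ3.Theorems.PercNearOneGluingNoHeavyLowerTailSahiPair43LinkNodePrelim

/-!
# `NoHeavyLowerTail` (crux stmt-CriticalPhenomena-4575), Sahi programme: the cell `(4,3)` — **link, the node of a pair**: a pair of
# up-sets satisfying `PairCond`, in symmetry normal form, is one of the colourings examined by the checker

Support file (Sahi cell `prim-sahi`, seat `prim-sahi-typer` gen 32; `--supports stmt-CriticalPhenomena-4575`).  Pure proofs; no `sorry`,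
standard axioms.

For a pair `(A, B)` with `PairCond A B` let `N = coGen A ∪ coGen B` (nonempty), `l = nodeList N`, `mm = colourCode l (clsA A)`.  Then
* `maskSet_pairA/B`: the two masks pushed for the colouring `mm` of the node `l` represent exactly `A` and `B`;
* `nA_eq`, `p2bad_eq_false`, `pushed_of_pairCond`: the colouring passes both filters (class sizes `|coGen A|, |coGen B| ≤ |Q| ≤
  chainCount(free)`; the minimal-element filter cannot fire by `minMask_sound` + `PairCond.minA/minB`);
* **`inDual_of_node`**: hence, if the chunk containing the node passes, `InDual (yProfile A B)` — for pairs whose node has sorted signature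
  and whose lowest code lies in `coGen A` (the general pair is reduced to this case in `…LinkFinal`). [this work]
-/

namespace Summit.CriticalPhenomena.PercolationContinuityZ3.Theorems.SahiGridPattern.Pair43

open Finset SahiGrid3 SahiGridPattern
open scoped BigOperators

section Node

variable {A B : Finset (Pd 4)} (h : PairCond A B)
include h

local notation "PA" => clsA A
local notation "NN" => (coGen A ∪ coGen B)

/-- Bits of the first pushed mask: `p ∈ A`. [this work] -/
theorem testBit_pairA_enc (p : Pd 4) (h0 : (PA) ((nodeList NN).getD 0 0) = true) :
    (pairA (nodeList NN).toArray (colourCode (nodeList NN) PA)).testBit (enc p) = decide (p ∈ A) := by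
  unfold pairA
  rw [testBit_compl81, testBit_classDown₁]
  simp only [enc_lt, decide_true, Bool.true_and, List.size_toArray, getD_nodeList_toArray]
  -- the `any` says: `p` lies below a co-generator of `A`
  have key : ((List.range (nodeList NN).length).any fun i =>
      cls (colourCode (nodeList NN) PA) i && (downT.getD ((nodeList NN).getD i 0) 0).testBit (enc p)) = true ↔
      ∃ x ∈ coGen A, p ≤ x := by
    rw [List.any_eq_true]
    have e1 : (∃ i ∈ List.range (nodeList NN).length, (cls (colourCode (nodeList NN) PA) i &&
        (downT.getD ((nodeList NN).getD i 0) 0).testBit (enc p)) = true) ↔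
        ∃ i ∈ List.range (nodeList NN).length, ((PA) ((nodeList NN).getD i 0) &&
          (downT.getD ((nodeList NN).getD i 0) 0).testBit (enc p)) = true := by
      refine exists_congr fun i => and_congr_right fun hi => ?_
      rw [cls_colourCode h0 (List.mem_range.1 hi)]
    rw [e1, exists_index_iff (nodeList NN) fun k => ((PA) k && (downT.getD k 0).testBit (enc p)) = true]
    constructor
    · rintro ⟨k, hk, hq⟩
      rw [Bool.and_eq_true, clsA_eq_true] at hq
      obtain ⟨x, hx, rfl⟩ := mem_codes.1 hq.1
      refine ⟨x, hx, ?_⟩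
      have := hq.2
      rw [testBit_downT (enc_lt x)] at this
      simp only [enc_lt, decide_true, Bool.true_and] at this
      exact (leC_enc p x).1 this
    · rintro ⟨x, hx, hpx⟩
      refine ⟨enc x, mem_nodeList.2 (enc_mem_codes.2 (mem_union_left _ hx)), ?_⟩
      rw [Bool.and_eq_true, clsA_eq_true, testBit_downT (enc_lt x)]
      exact ⟨enc_mem_codes.2 hx, by simp [enc_lt, (leC_enc p x).2 hpx]⟩
  by_cases hp : p ∈ A
  · have : ¬ ∃ x ∈ coGen A, p ≤ x := fun hx => (not_mem_iff_exists_coGen h.upA p).2 hx hp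
    rw [← key] at this
    simp only [hp, decide_true]
    cases hb : ((List.range (nodeList NN).length).any fun i =>
      cls (colourCode (nodeList NN) PA) i && (downT.getD ((nodeList NN).getD i 0) 0).testBit (enc p))
    · rfl
    · exact absurd hb this
  · have hx := (not_mem_iff_exists_coGen h.upA p).1 hp
    rw [← key] at hx
    rw [hx]; simp [hp]

/-- Bits of the second pushed mask: `p ∈ B`. [this work] -/
theorem testBit_pairB_enc (p : Pd 4) (h0 : (PA) ((nodeList NN).getD 0 0) = true) :
    (pairB (nodeList NN).toArray (colourCode (nodeList NN) PA)).testBit (enc p) = decide (p ∈ B) := by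
  unfold pairB
  rw [testBit_compl81, testBit_classDown₂]
  simp only [enc_lt, decide_true, Bool.true_and, List.size_toArray, getD_nodeList_toArray]
  have key : ((List.range (nodeList NN).length).any fun i =>
      !(cls (colourCode (nodeList NN) PA) i) && (downT.getD ((nodeList NN).getD i 0) 0).testBit (enc p)) = true ↔
      ∃ x ∈ coGen B, p ≤ x := by
    rw [List.any_eq_true]
    have e1 : (∃ i ∈ List.range (nodeList NN).length, (!(cls (colourCode (nodeList NN) PA) i) &&
        (downT.getD ((nodeList NN).getD i 0) 0).testBit (enc p)) = true) ↔
        ∃ i ∈ List.range (nodeList NN).length, ((!(PA) ((nodeList NN).getD i 0)) &&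
          (downT.getD ((nodeList NN).getD i 0) 0).testBit (enc p)) = true := by
      refine exists_congr fun i => and_congr_right fun hi => ?_
      rw [cls_colourCode h0 (List.mem_range.1 hi)]
    rw [e1, exists_index_iff (nodeList NN) fun k => ((!(PA) k) && (downT.getD k 0).testBit (enc p)) = true]
    constructor
    · rintro ⟨k, hk, hq⟩
      rw [Bool.and_eq_true] at hq
      obtain ⟨x, hxN, rfl⟩ := mem_codes.1 (mem_nodeList.1 hk)
      have hxB : x ∈ coGen B := by
        rcases mem_union.1 hxN with hxA | hxB
        · have := hq.1; rw [Bool.not_eq_true', ← Bool.not_eq_true, clsA_eq_true] at this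
          exact absurd (enc_mem_codes.2 hxA) this
        · exact hxB
      refine ⟨x, hxB, ?_⟩
      have := hq.2
      rw [testBit_downT (enc_lt x)] at this
      simp only [enc_lt, decide_true, Bool.true_and] at this
      exact (leC_enc p x).1 this
    · rintro ⟨x, hx, hpx⟩
      refine ⟨enc x, mem_nodeList.2 (enc_mem_codes.2 (mem_union_right _ hx)), ?_⟩
      have hxA : x ∉ coGen A := fun hxA => Finset.disjoint_left.1 (pairCond_disjoint h) hxA hx
      rw [Bool.and_eq_true, testBit_downT (enc_lt x), Bool.not_eq_true', ← Bool.not_eq_true, clsA_eq_true, enc_mem_codes]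
      exact ⟨hxA, by simp [enc_lt, (leC_enc p x).2 hpx]⟩
  by_cases hp : p ∈ B
  · have : ¬ ∃ x ∈ coGen B, p ≤ x := fun hx => (not_mem_iff_exists_coGen h.upB p).2 hx hp
    rw [← key] at this
    simp only [hp, decide_true]
    cases hb : ((List.range (nodeList NN).length).any fun i =>
      !(cls (colourCode (nodeList NN) PA) i) && (downT.getD ((nodeList NN).getD i 0) 0).testBit (enc p))
    · rfl
    · exact absurd hb this
  · have hx := (not_mem_iff_exists_coGen h.upB p).1 hp
    rw [← key] at hx
    rw [hx]; simp [hp]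

/-- **The first pushed mask represents `A`.** [this work] -/
theorem maskSet_pairA (h0 : (PA) ((nodeList NN).getD 0 0) = true) :
    maskSet (pairA (nodeList NN).toArray (colourCode (nodeList NN) PA)) = A := by
  ext p; unfold maskSet
  rw [mem_filter, testBit_pairA_enc h p h0]; simp

/-- **The second pushed mask represents `B`.** [this work] -/
theorem maskSet_pairB (h0 : (PA) ((nodeList NN).getD 0 0) = true) :
    maskSet (pairB (nodeList NN).toArray (colourCode (nodeList NN) PA)) = B := by
  ext p; unfold maskSet
  rw [mem_filter, testBit_pairB_enc h p h0]; simp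

/-! ### The filters pass -/

omit h in
/-- **The first class has `|coGen A|` points.** [this work] -/
theorem nA_eq (hne : (coGen A ∪ coGen B).Nonempty) (h0 : (PA) ((nodeList NN).getD 0 0) = true) :
    nA (nodeList NN).length (colourCode (nodeList NN) PA) = (coGen A).card := by
  unfold nA
  rw [countBelow_eq]
  have e1 : (List.range ((nodeList NN).length - 1)).filter (fun j => (colourCode (nodeList NN) PA).testBit j) =
      (List.range ((nodeList NN).length - 1)).filter fun j => (PA) ((nodeList NN).getD (j + 1) 0) := by
    refine List.filter_congr fun j hj => ?_
    rw [testBit_colourCode]; simp [List.mem_range.1 hj]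
  rw [e1]
  -- split off the lowest code, which is in the first class
  have hlen : (nodeList NN).length ≠ 0 := by rw [length_nodeList]; exact Nat.pos_iff_ne_zero.1 (card_pos.2 hne)
  obtain ⟨x, l, hl⟩ : ∃ x l, nodeList NN = x :: l := by
    cases hq : nodeList NN with
    | nil => rw [hq] at hlen; exact absurd rfl hlen
    | cons x l => exact ⟨x, l, rfl⟩
  have hcount : ((nodeList NN).filter PA).length = (coGen A).card := by
    rw [← List.toFinset_card_of_nodup ((nodeList_nodup _).filter _), List.toFinset_filter, nodeList_toFinset, ← card_codes (coGen A)]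
    congr 1
    ext k
    rw [mem_filter, clsA_eq_true]
    refine ⟨fun hk => hk.2, fun hk => ⟨?_, hk⟩⟩
    obtain ⟨p, hp, rfl⟩ := mem_codes.1 hk
    exact enc_mem_codes.2 (mem_union_left _ hp)
  rw [← hcount, hl]
  rw [hl] at h0
  have hx : clsA A x = true := h0
  rw [List.filter_cons, if_pos hx]
  simp only [List.length_cons, Nat.add_sub_cancel]
  have e2 : (List.range l.length).filter (fun j => (PA) ((x :: l).getD (j + 1) 0)) =
      (List.range l.length).filter fun j => (PA) (l[j]?.getD 0) := by
    refine List.filter_congr fun j _ => ?_; rfl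
  rw [e2, length_filter_range_getD]
  ring

/-- **The minimal-element filter does not fire** on the colouring of a `PairCond` pair. [this work] -/
theorem p2bad_eq_false (h0 : (PA) ((nodeList NN).getD 0 0) = true) :
    p2bad (pairA (nodeList NN).toArray (colourCode (nodeList NN) PA)) (pairB (nodeList NN).toArray (colourCode (nodeList NN) PA))
      (orTab upT (nodeList NN).toArray) = false := by
  by_contra hbad
  rw [Bool.not_eq_false] at hbad
  unfold p2bad at hbad
  rw [bne_iff_ne, ne_eq] at hbad
  obtain ⟨j, hj⟩ := Nat.exists_testBit_of_ne_zero hbad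
  rw [Nat.testBit_and, Bool.and_eq_true, testBit_orTab, List.any_eq_true] at hj
  obtain ⟨hj, x, hx, hxj⟩ := hj
  rw [Array.mem_toList_iff, List.mem_toArray] at hx
  obtain ⟨z, hz, rfl⟩ := mem_codes.1 (mem_nodeList.1 hx)
  rw [testBit_upT (enc_lt z), Bool.and_eq_true, decide_eq_true_eq] at hxj
  obtain ⟨p, rfl⟩ := exists_enc_eq hxj.1
  have hzp : z ≤ p := (leC_enc z p).1 hxj.2
  have hrA : Rep (pairA (nodeList NN).toArray (colourCode (nodeList NN) PA)) A := by
    have := rep_maskSet (pairA (nodeList NN).toArray (colourCode (nodeList NN) PA)); rwa [maskSet_pairA h h0] at this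
  have hrB : Rep (pairB (nodeList NN).toArray (colourCode (nodeList NN) PA)) B := by
    have := rep_maskSet (pairB (nodeList NN).toArray (colourCode (nodeList NN) PA)); rwa [maskSet_pairB h h0] at this
  rw [Nat.testBit_or, Bool.or_eq_true, Nat.testBit_and, Nat.testBit_and, Bool.and_eq_true, Bool.and_eq_true] at hj
  rcases hj with ⟨hmin, hpB⟩ | ⟨hmin, hpA⟩
  · have hpB' : p ∈ B := by rw [hrB p] at hpB; exact of_decide_eq_true hpB
    exact (h.minA p (minMask_sound h.upA hrA hmin) hpB' z hz).2 hzp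
  · have hpA' : p ∈ A := by rw [hrA p] at hpA; exact of_decide_eq_true hpA
    exact (h.minB p (minMask_sound h.upB hrB hmin) hpA' z hz).2 hzp

/-- **Both filters pass** for the colouring of a `PairCond` pair. [this work] -/
theorem pushed_of_pairCond (hne : (coGen A ∪ coGen B).Nonempty) (h0 : (PA) ((nodeList NN).getD 0 0) = true) :
    Pushed (nodeList NN).toArray (chainCount (compl81 (orTab cmpT (nodeList NN).toArray))) (orTab upT (nodeList NN).toArray)
      (colourCode (nodeList NN) PA) := by
  obtain ⟨Q, hQfree, hQanti, hQA, hQB⟩ := h.big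
  have hQ := card_le_chainCount hQfree hQanti
  refine ⟨?_, p2bad_eq_false h h0⟩
  rw [List.size_toArray, nA_eq hne h0, length_nodeList, card_union_of_disjoint (pairCond_disjoint h), Nat.add_sub_cancel_left]
  omega

/-- **The node theorem**: if the chunk of the node of `N = coGen A ∪ coGen B` passes, the node has sorted signature and its lowest
code is a co-generator of `A`, then the y-profile of `(A, B)` lies in the dual cone of the up-sets. [this work] -/
theorem inDual_of_node {m r : ℕ} (hc : chunkCheck m r = true) (hne : (coGen A ∪ coGen B).Nonempty)
    (h0 : (nodeList NN).getD 0 0 ∈ codes (coGen A))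
    (hsig : sigP 0 NN ≤ sigP 1 NN ∧ sigP 1 NN ≤ sigP 2 NN ∧ sigP 2 NN ≤ sigP 3 NN)
    (hr : ptsHash (nodeList NN).toArray % m = r) : InDual (yProfile A B) := by
  have h0' : (PA) ((nodeList NN).getD 0 0) = true := clsA_eq_true.2 h0
  have hlen : (nodeList NN).length ≠ 0 := by rw [length_nodeList]; exact Nat.pos_iff_ne_zero.1 (card_pos.2 hne)
  have hE : nodeList NN ≠ [] := fun e => hlen (by rw [e]; rfl)
  have hgood := chunkCheck_sound hc hE (adm_nodeList h) (by
      rw [pushList_nil, sigAdd_nodeList, sigAdd_nodeList, sigAdd_nodeList, sigAdd_nodeList]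
      exact ⟨hsig.1, hsig.2.1, hsig.2.2, hr⟩)
    (by rw [pushList_nil, List.size_toArray]; exact hlen)
    (mm := colourCode (nodeList NN) PA) (by rw [pushList_nil, List.size_toArray]; exact colourCode_lt _ _)
    (by rw [pushList_nil]; exact pushed_of_pairCond h hne h0')
  rw [pushList_nil] at hgood
  unfold GoodPair at hgood
  rwa [maskSet_pairA h h0', maskSet_pairB h h0'] at hgood

end Node

end Summit.CriticalPhenomena.PercolationContinuityZ3.Theorems.SahiGridPattern.Pair43
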